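/-
Copyright (c) 2026 the pub-hodgecm-mathlib formalisation cell (harness21).  Prover seat hodgecm-mathlib-LH4-p19 (g2), req620 Track A «(D-RAM) FOUR-FRAME» squad
(STAGE-1b, row (2) of the piece `f_{T₊}`, the (β₂) road (R-36) «PURE-CELL LEDGER»; β₂ sub-dealer LH4-p04 (g9) BETA2-BOARD v2 row (ROW-D♭), dealt by name; the digit
count assembled across `jE`), 2026-09-04.
-/
import Summits.HodgeConjecture.HodgeConjecture.Theorems.F0P3cDyRamDiagonalCellLiteralDigits   -- ★ p862758 (this seat, K2): `two_mul_card_filter_lit_eq_card`; brings ★ p862655 (K1) `card_filter_lit_plus_eq_card_filter_lit_not`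
import HarnessLib

/-!
# Crux `H413`, line LH4 «(D-RAM) FOUR-FRAME» — STAGE-1b, row (2), the (β₂) road (R-36), lane B, row (ROW-D♭), THE COUNT — «THE AFFINE LABEL IS BALANCED ON THE LITERAL
# DIGITS» — the E-side count ★ p862655 fed with the K♮-side halving ★ p862758 across `jE`: for the literal predicate `LIT(V) :⟺ ω_Θ(ŵ(jE V)∕c) = 1` of the diagonal cell,
# `#{V ∈ R_d ∣ LIT V ∧ ω_σ(α₁ + γ₁V) = 1} = #{V ∈ R_d ∣ LIT V ∧ ¬ ω_σ(α₁ + γ₁V) = 1}` (`1 ≤ g ≤ d − 1`)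

Cell `hodgecm-mathlib` (D-0151), FLOOR 0, crux item H413 = `stmt-HodgeConjecture-24833`, route of record `HCCMUnconditional`; squad F0∕P3c∕LH4; lane
`--supports stmt-HodgeConjecture-24833 --as helper` (count-neutral; pays NO tier-0 row).  THEOREMS ONLY (no `def`, no instance, no notation, no `sorry`, default heartbeats);
★-only imports; states NO law; (β₂) stays a HYPOTHESIS.  DATUM-FREE two-field letters: `E` with the sheet datum `(σ, ϖ, d, t)`, the line model `M` with `ρ`, `Θ` and the
RamK datum `(Θ, jE ϖ, d, t_M)`, `jE : E →+* M` isometric onto `Fix ρ` with `Θ ∘ jE = jE ∘ σ`; digit systems `R_d`, `R′` of `𝒪_F` (σ-fixed integers of `E`).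

WHY.  ★ p862655 `card_filter_lit_plus_eq_card_filter_lit_not` balances the affine label `ω_σ(α₁ + γ₁V)` on the `LIT`-part of the fine digits `R_d` PROVIDED `LIT` halves every
coarse-digit fibre; ★ p862758 `two_mul_card_filter_lit_eq_card` proves exactly that halving for `LIT(V) = [ω_Θ(ŵ(V)∕c) = 1]` on M-side digit systems.  THIS FILE transports
the E-side fibre `{V ∈ R_d ∣ |V − V₀| ≤ |ϖ|^{2(d−g)}}` through `jE` into an M-side digit system of one tail-digit orbit (`jE` is injective, isometric, `σ`-fixed ↦ doubly fixed)
and assembles the two ★ heads: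
* §1 `image_digit_system` — the `jE`-image of an E-side orbit fibre is an M-side digit system (the three clauses of ★ p862758's `F`).
* §2 HEAD `card_filter_lit_affine_eq` — `#{V ∈ R_d ∣ LIT V ∧ ω_σ(α₁ + γ₁V) = 1} = #{V ∈ R_d ∣ LIT V ∧ ¬ ω_σ(α₁ + γ₁V) = 1}` for `LIT(V) = [ω_Θ(ŵ(jE V)∕c) = 1]`, `c` any
  `Θ`-fixed unit, `α₁, γ₁ ∈ F` with `|α₁| = 1`, `|γ₁| = |ϖ|^{2g}`, `1 ≤ g ≤ d − 1`.
WHAT IS NOT CLAIMED: the lattice fibration (★-cand K5b) and the lattice-level assembly (K6b); the identification of `LIT` with the literal of the cell and of the affine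
label with the vertex label (K3 ∕ ★ p862875-cand K4).
HONEST LABEL.  Count-neutral finite counting; nothing printed is asserted; no census law is stated; `HC_CM` is proved only modulo the 7 printed citations (2 remaining named
inputs: hLiu418 = `stmt-HodgeConjecture-24832`, h413 = `stmt-HodgeConjecture-24833`) until rung 0 closes.
## References
* [Serre1979] J.-P. Serre, *Local Fields*, GTM 67 (1979): Ch. V §3 Cor. 3 pp. 85–87 (conductor), Ch. V §2 Prop. 3, Ch. XV §2.
* [Kottwitz1986BaseChangeUnits] R. E. Kottwitz, *Base change for unit elements of Hecke algebras*, Compositio Math. 60 (1986): §1 pp. 240–241.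
* [Rogawski1990] J. D. Rogawski, *Automorphic Representations of Unitary Groups in Three Variables*, Ann. of Math. Stud. 123 (1990): §4.9 Prop. 4.9.1 (b) p. 55, §12.2.
* [LabesseLanglands1979] J.-P. Labesse, R. P. Langlands, *L-indistinguishability for SL(2)*, Canad. J. Math. 31 (1979): §2 (2.2) p. 9.
-/

set_option autoImplicit false

noncomputable section

namespace Summit.HodgeConjecture.HodgeConjecture.Cruxes.H413.F0P3cDyRamDiagonalCellDigitBalance

open scoped Valued WithZero Classical
open WithZero Finset
open Literature.NumberTheory.Automorphic.UnitaryThreeFourFrame (IsRamifiedQuadraticDatum normSign)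
open Summit.HodgeConjecture.HodgeConjecture.Cruxes.H413.F0P3cDyRamDiagonalCellLabelDigits (card_filter_lit_plus_eq_card_filter_lit_not)
open Summit.HodgeConjecture.HodgeConjecture.Cruxes.H413.F0P3cDyRamDiagonalCellLiteralDigits (two_mul_card_filter_lit_eq_card)

variable {E M : Type} [Field E] [Valued E ℤᵐ⁰] [Field M] [Valued M ℤᵐ⁰] {σ : E →+* E} {ρ Θ : M →+* M} {ϖ : E} {d t : ℕ}

/-! ## §1 The `jE`-image of an E-side orbit fibre is an M-side digit system -/

/-- **TRANSPORT OF A DIGIT FIBRE THROUGH `jE`.**  `jE` isometric (`|jE a| = |a|`) onto `Fix ρ` (`hjfix`), `Θ ∘ jE = jE ∘ σ`; `R_d` a complete irredundant system of `σ`-fixed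
integers modulo `|·| ≤ |ϖ|^{2d}`; `V₀ ∈ E` any centre; `k ≤ d`.  THEN `F := jE '' {V ∈ R_d ∣ |V − V₀| ≤ |ϖ|^{2(d−k)}}` satisfies the three digit-system clauses of
★ p862758 for the orbit `{V ∣ |V − jE V₀| ≤ |jEϖ|^{2(d−k)}}` modulo `|·| ≤ |jEϖ|^{2d}`. [cite: Serre1979, Ch. V §2 Prop. 3] [cite: Kottwitz1986BaseChangeUnits, §1 pp. 240–241] -/
theorem image_digit_system (jE : E →+* M) (hjiso : ∀ a, Valued.v (jE a) = Valued.v a) (hjfix : ∀ z : M, ρ z = z ↔ ∃ a, jE a = z) (hΘj : ∀ a, Θ (jE a) = jE (σ a))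
    (Rd : Finset E) (hRd1 : ∀ V ∈ Rd, σ V = V ∧ Valued.v V ≤ 1)
    (hRd2 : ∀ V : E, σ V = V → Valued.v V ≤ 1 → ∃ V₁ ∈ Rd, Valued.v (V - V₁) ≤ Valued.v ϖ ^ (2 * d))
    (hRd3 : ∀ V ∈ Rd, ∀ V' ∈ Rd, Valued.v (V - V') ≤ Valued.v ϖ ^ (2 * d) → V = V')
    {V₀ : E} {k : ℕ} (hkd : k ≤ d) (hϖ1 : Valued.v ϖ ≤ 1) :
    (∀ W ∈ (Rd.filter fun V => Valued.v (V - V₀) ≤ Valued.v ϖ ^ (2 * (d - k))).image jE,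
        ρ W = W ∧ Θ W = W ∧ Valued.v W ≤ 1 ∧ Valued.v (W - jE V₀) ≤ Valued.v (jE ϖ) ^ (2 * (d - k))) ∧
      (∀ W : M, ρ W = W → Θ W = W → Valued.v W ≤ 1 → Valued.v (W - jE V₀) ≤ Valued.v (jE ϖ) ^ (2 * (d - k)) →
        ∃ W₁ ∈ (Rd.filter fun V => Valued.v (V - V₀) ≤ Valued.v ϖ ^ (2 * (d - k))).image jE, Valued.v (W - W₁) ≤ Valued.v (jE ϖ) ^ (2 * d)) ∧
      (∀ W ∈ (Rd.filter fun V => Valued.v (V - V₀) ≤ Valued.v ϖ ^ (2 * (d - k))).image jE,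
        ∀ W' ∈ (Rd.filter fun V => Valued.v (V - V₀) ≤ Valued.v ϖ ^ (2 * (d - k))).image jE, Valued.v (W - W') ≤ Valued.v (jE ϖ) ^ (2 * d) → W = W') := by
  classical
  have hjinj : Function.Injective jE := jE.injective
  refine ⟨?_, ?_, ?_⟩
  · intro W hW
    obtain ⟨V, hV, rfl⟩ := mem_image.1 hW
    obtain ⟨hVR, hVnear⟩ := mem_filter.1 hV
    obtain ⟨hσV, hV1⟩ := hRd1 V hVR
    refine ⟨(hjfix _).2 ⟨V, rfl⟩, by rw [hΘj, hσV], by rw [hjiso]; exact hV1, ?_⟩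
    rw [← map_sub, hjiso, hjiso]; exact hVnear
  · intro W hρW hΘW hW1 hWnear
    obtain ⟨V, rfl⟩ := (hjfix W).1 hρW
    have hσV : σ V = V := hjinj (by rw [← hΘj, hΘW])
    have hV1 : Valued.v V ≤ 1 := by rw [← hjiso]; exact hW1
    obtain ⟨V₁, hV₁R, hVV₁⟩ := hRd2 V hσV hV1
    have hVnear : Valued.v (V - V₀) ≤ Valued.v ϖ ^ (2 * (d - k)) := by rw [← hjiso, map_sub, ← hjiso ϖ]; exact hWnear
    refine ⟨jE V₁, mem_image.2 ⟨V₁, mem_filter.2 ⟨hV₁R, ?_⟩, rfl⟩, by rw [← map_sub, hjiso, hjiso]; exact hVV₁⟩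
    have e : V₁ - V₀ = (V - V₀) - (V - V₁) := by ring
    rw [e]
    exact (Valuation.map_sub _ _ _).trans (max_le hVnear (hVV₁.trans (pow_le_pow_right_of_le_one' hϖ1 (by omega))))
  · intro W hW W' hW' hWW'
    obtain ⟨V, hV, rfl⟩ := mem_image.1 hW
    obtain ⟨V', hV', rfl⟩ := mem_image.1 hW'
    rw [← map_sub, hjiso, hjiso] at hWW'
    rw [hRd3 V (mem_filter.1 hV).1 V' (mem_filter.1 hV').1 hWW']

/-! ## §2 HEAD — the affine label is balanced on the literal digits -/

/-- **HEAD — «THE AFFINE LABEL IS BALANCED ON THE LITERAL DIGITS».**  E-side: a complete sheet datum `IsRamifiedQuadraticDatum σ ϖ d t` with finite residue field, `|2| < 1`;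
`α₁, γ₁` `σ`-fixed with `|α₁| = 1`, `|γ₁| = |ϖ|^{2g}`, `1 ≤ g`, `g + 1 ≤ d`; digit systems `R_d` (mod `|·| ≤ |ϖ|^{2d}`) and `R′` (mod `|·| ≤ |ϖ|^{2(d−g)}`).  M-side: `ρ`, `Θ`
commuting isometric involutions with the RamK datum `IsRamifiedQuadraticDatum Θ (jE ϖ) d t_M` (complete, finite residue field, `|2| < 1`), `hFN`, a `Θ`-fixed pivot `θ₀` with
`|θ₀ − ρθ₀| = 1`, a `Θ`-fixed unit `c`; `jE` isometric onto `Fix ρ` with `Θ ∘ jE = jE ∘ σ`.  With `LIT(V) :⟺ ω_Θ(ŵ(jE V)∕c) = 1`, `ŵ(W) = (W − ρθ₀)∕(θ₀ − ρθ₀)`: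
`#{V ∈ R_d ∣ LIT V ∧ ω_σ(α₁ + γ₁V) = 1} = #{V ∈ R_d ∣ LIT V ∧ ¬ ω_σ(α₁ + γ₁V) = 1}` (★ p862655 HEAD ∘ ★ p862758 halving on each `jE`-transported orbit fibre).
[cite: Serre1979, Ch. V §3 Cor. 3 pp. 85–87] [cite: Kottwitz1986BaseChangeUnits, §1 pp. 240–241] [cite: Rogawski1990, §4.9 Prop. 4.9.1 (b) p. 55] [cite: LabesseLanglands1979, §2 (2.2) p. 9] -/
theorem card_filter_lit_affine_eq [CompleteSpace E] [Finite 𝓀[E]] [CompleteSpace M] [Finite 𝓀[M]]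
    (hD : IsRamifiedQuadraticDatum σ ϖ d t) (h2v : Valued.v (2 : E) < 1)
    {α₁ γ₁ : E} (hσα : σ α₁ = α₁) (hα1 : Valued.v α₁ = 1) (hσγ : σ γ₁ = γ₁) {g : ℕ} (hγ : Valued.v γ₁ = Valued.v ϖ ^ (2 * g)) (hg1 : 1 ≤ g) (hgd : g + 1 ≤ d)
    (Rd : Finset E) (hRd1 : ∀ V ∈ Rd, σ V = V ∧ Valued.v V ≤ 1)
    (hRd2 : ∀ V : E, σ V = V → Valued.v V ≤ 1 → ∃ V₀ ∈ Rd, Valued.v (V - V₀) ≤ Valued.v ϖ ^ (2 * d))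
    (hRd3 : ∀ V ∈ Rd, ∀ V' ∈ Rd, Valued.v (V - V') ≤ Valued.v ϖ ^ (2 * d) → V = V')
    (R' : Finset E) (hR'1 : ∀ V ∈ R', σ V = V ∧ Valued.v V ≤ 1)
    (hR'2 : ∀ V : E, σ V = V → Valued.v V ≤ 1 → ∃ V₀ ∈ R', Valued.v (V - V₀) ≤ Valued.v ϖ ^ (2 * (d - g)))
    (hR'3 : ∀ V ∈ R', ∀ V' ∈ R', Valued.v (V - V') ≤ Valued.v ϖ ^ (2 * (d - g)) → V = V')
    (jE : E →+* M) (hjiso : ∀ a, Valued.v (jE a) = Valued.v a) (hjfix : ∀ z : M, ρ z = z ↔ ∃ a, jE a = z) (hΘj : ∀ a, Θ (jE a) = jE (σ a))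
    {tM : ℕ} (hDM : IsRamifiedQuadraticDatum Θ (jE ϖ) d tM) (h2M : Valued.v (2 : M) < 1)
    (hρρ : ∀ x, ρ (ρ x) = x) (hvρ : ∀ x, Valued.v (ρ x) = Valued.v x) (hΘρ : ∀ x, Θ (ρ x) = ρ (Θ x))
    (hFN : ∀ f : M, ρ f = f → Θ f = f → Valued.v f = 1 → ∃ z : M, z * Θ z = f)
    {θ₀ : M} (hΘθ₀ : Θ θ₀ = θ₀) (hθ1 : Valued.v θ₀ ≤ 1) (hθρ : Valued.v (θ₀ - ρ θ₀) = 1) {c : M} (hΘc : Θ c = c) (hc1 : Valued.v c = 1) :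
    ((Rd.filter fun V => normSign Θ ((jE V - ρ θ₀) / (θ₀ - ρ θ₀) / c) = 1).filter fun V => normSign σ (α₁ + γ₁ * V) = 1).card =
      ((Rd.filter fun V => normSign Θ ((jE V - ρ θ₀) / (θ₀ - ρ θ₀) / c) = 1).filter fun V => ¬ normSign σ (α₁ + γ₁ * V) = 1).card := by
  classical
  have hϖ1 : Valued.v ϖ ≤ 1 := by rw [hD.2.2.1, ← exp_zero, exp_le_exp]; norm_num
  refine card_filter_lit_plus_eq_card_filter_lit_not hD h2v hσα hα1 hσγ hγ hg1 hgd Rd hRd1 hRd2 hRd3 R' hR'1 hR'2 hR'3 _ fun V₀ hV₀ => ?_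
  -- the halving on the transported fibre
  obtain ⟨hF1, hF2, hF3⟩ := image_digit_system jE hjiso hjfix hΘj Rd hRd1 hRd2 hRd3 (V₀ := V₀) (k := g) (by omega) hϖ1
  have hhalfM := two_mul_card_filter_lit_eq_card hDM h2M hρρ hvρ hΘρ hFN hΘθ₀ hθ1 hθρ hΘc hc1 hg1 hgd (V₀ := jE V₀)
    ((Rd.filter fun V => Valued.v (V - V₀) ≤ Valued.v ϖ ^ (2 * (d - g))).image jE) hF1 hF2 hF3
  -- pull the counts back along the injective `jE`
  have hjinj : Function.Injective jE := jE.injective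
  rw [card_image_of_injective _ hjinj] at hhalfM
  rw [filter_image, card_image_of_injective _ hjinj] at hhalfM
  -- commute the two filters on the E-side
  have hcomm : ((Rd.filter fun V => Valued.v (V - V₀) ≤ Valued.v ϖ ^ (2 * (d - g))).filter
        fun V => normSign Θ ((jE V - ρ θ₀) / (θ₀ - ρ θ₀) / c) = 1) =
      ((Rd.filter fun V => normSign Θ ((jE V - ρ θ₀) / (θ₀ - ρ θ₀) / c) = 1).filter fun V => Valued.v (V - V₀) ≤ Valued.v ϖ ^ (2 * (d - g))) := by
    rw [filter_filter, filter_filter]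
    exact filter_congr fun V _ => and_comm
  rw [hcomm] at hhalfM
  exact hhalfM

end Summit.HodgeConjecture.HodgeConjecture.Cruxes.H413.F0P3cDyRamDiagonalCellDigitBalance

end
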